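import Mathlib
import Summits.Ventures.HodgeRepro.Tier4.Target
import Summits.Ventures.HodgeRepro.Tier4.Line3.KMDatum
import Summits.Ventures.HodgeRepro.Tier4.Line3.KMDatumS
import Summits.Ventures.HodgeRepro.Tier4.Line3.Defs
import Summits.Ventures.HodgeRepro.Tier4.Line3.DefsLemmas

/-!
# Tier4/Line3/LocalizerSet — the assembly of LINE L3 with a MAIN SET of orbits in place of one main orbit
((R4) of the v0.39 repair design, plan-3 g2 S13393, cut to t4-x2 g2 by the lead S13430)

Blind re-derivation cell `pub-hodge-repro`, Tier 4 «PROVE THE STEP» (README §9–§10), LINE L3 (orbit expansion of the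
quadruple theta period), seat t4-x2 (reserve wall-breaker, g2).  Mathlib-level, Defs-level: nothing here mentions a datum,
a localiser or a place — the objects are the abstract `OrbitExpansion Orbit pairing term` of `Tier4/Line3/Defs.lean`
(Part I) and ITS assembly.  Consumed by the successor planner's skeleton for WHICHEVER main set the repair adopts
(L2-p3's `GramRay`, RayMinor p678692, or the per-slot scalar family of S13421 (3)): `mainSet` is an abstract
`Set Orbit` here, never defined.

## Why a main SET (O-L3-8, S13369 / S13393 / S13421)

`LocS.supp` was unsatisfiable by the natural localiser (the scalar copies of the centre persist at every depth), so the
line's `Localizer` (ONE main orbit, every other orbit tends to `0`) cannot be built from the natural data.  The honest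
assembly keeps a SET of persistent orbits: off the set the terms tend to `0` under one summable majorant (dominated
convergence, exactly as `Localizer.tail_tendsto`); on the set the terms are controlled through their REAL PARTS.

## The two structures

* `LocalizerSum` — the general form: `mainSet`, the depth-`N` levels and translates, `tendsto_zero` OFF the set, one
  summable majorant `bound` of every term off ONE distinguished orbit `main ∈ mainSet`, and the clause
  `main_sum_lower`: the REAL PART of the SUM of the terms over `mainSet` is eventually `≥ m > 0`.  This is the shape the
  corrected mechanism of S13421 §6 produces (the unit-scaled copies positive, a displayed Gaussian-small remainder).
* `LocalizerSet` — plan-3's (R4) verbatim: `main_pos` (from some depth on every term of `mainSet` is a non-negative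
  real) and `main_lower` (the real part of the term of `main` is eventually `≥ m > 0`); `LocalizerSet.toLocalizerSum`
  shows it is the special case «termwise positivity on the set» (`Complex.re_tsum` + `Summable.le_tsum`).

`LocalizerSum.P` / `LocalizerSet.P : ∃ K γ, pairing K γ ≠ 0` — the conclusion of the assembly, the same finite logic as
`Localizer.P` (`Tier4/Line3/DefsLemmas.lean`): `pairing N = mainPart N + offPart N`, `offPart N → 0` (Tannery on the
majorant), `Re (mainPart N) ≥ m`, so `Re (pairing N) > m / 2 > 0` for `N` large.

Nothing here asserts anything about the truth of (P); whether the natural data give a `LocalizerSum` is the re-planned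
line's content (S13421 §6–§7).  HC_CM is NOT proved by anyone in this repository.
-/

set_option autoImplicit false

noncomputable section

namespace Summit.Ventures.HodgeRepro.Tier4.Line3

open Summit.Ventures.HodgeRepro.Tier4
open Filter Topology

open scoped Classical

section Assembly

variable {Level : Type} {Tr : Level → Type}

namespace OrbitExpansion

variable {Orbit : Type} {pairing : ∀ K : Level, Tr K → ℂ} {term : ∀ K : Level, Tr K → Orbit → ℂ}

/-- **LOCALISER WITH A MAIN SET, SUM FORM**: a set of persistent orbits, depth-`N` levels and translates, the terms
OFF the set tend to `0`, one summable majorant dominates every term off the distinguished orbit `main ∈ mainSet` at all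
depths, and the REAL PART of the sum of the terms over the set is eventually bounded below by `m > 0`. -/
structure LocalizerSum (E : OrbitExpansion Orbit pairing term) where
  /-- the persistent orbits -/
  mainSet : Set Orbit
  /-- the distinguished persistent orbit (the term the majorant does not dominate) -/
  main : Orbit
  main_mem : main ∈ mainSet
  /-- the level of the depth-`N` localiser -/
  level : ℕ → Level
  /-- the depth-`N` localising translate, of level `level N` -/
  loc : ∀ N : ℕ, Tr (level N)
  /-- off the main set the localiser's terms tend to `0` -/
  tendsto_zero : ∀ o : Orbit, o ∉ mainSet → Tendsto (fun N => term (level N) (loc N) o) atTop (𝓝 0)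
  /-- the real part of the sum over the main set is eventually bounded below -/
  main_sum_lower : ∃ m : ℝ, 0 < m ∧ ∀ᶠ N in atTop,
    m ≤ (∑' o : Orbit, if o ∈ mainSet then term (level N) (loc N) o else 0).re
  /-- one summable majorant of the terms off `main`, for all depths -/
  bound : Orbit → ℝ
  bound_nonneg : ∀ o, 0 ≤ bound o
  bound_summable : Summable bound
  norm_term_le : ∀ (N : ℕ) (o : Orbit), o ≠ main → ‖term (level N) (loc N) o‖ ≤ bound o

namespace LocalizerSum

variable {E : OrbitExpansion Orbit pairing term} (L : E.LocalizerSum)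

/-- The part of the expansion over the main set. -/
def mainPart (N : ℕ) : ℂ := ∑' o : Orbit, if o ∈ L.mainSet then term (L.level N) (L.loc N) o else 0

/-- The part of the expansion off the main set. -/
def offPart (N : ℕ) : ℂ := ∑' o : Orbit, if o ∈ L.mainSet then 0 else term (L.level N) (L.loc N) o

/-- The summand over the main set is summable (it is a restriction of the expansion's summand). -/
theorem summable_mainPart (N : ℕ) :
    Summable (fun o : Orbit => if o ∈ L.mainSet then term (L.level N) (L.loc N) o else 0) := by
  refine Summable.of_norm_bounded (E.summable_norm (L.level N) (L.loc N)) ?_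
  intro o
  by_cases ho : o ∈ L.mainSet
  · simp [ho]
  · simp [ho]

/-- The summand off the main set is summable. -/
theorem summable_offPart (N : ℕ) :
    Summable (fun o : Orbit => if o ∈ L.mainSet then 0 else term (L.level N) (L.loc N) o) := by
  refine Summable.of_norm_bounded (E.summable_norm (L.level N) (L.loc N)) ?_
  intro o
  by_cases ho : o ∈ L.mainSet
  · simp [ho]
  · simp [ho]

/-- The pairing at depth `N` is the main part plus the off part. -/
theorem pairing_eq (N : ℕ) : pairing (L.level N) (L.loc N) = L.mainPart N + L.offPart N := by
  rw [E.expansion (L.level N) (L.loc N), mainPart, offPart, ← (L.summable_mainPart N).tsum_add (L.summable_offPart N)]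
  refine tsum_congr fun o => ?_
  by_cases ho : o ∈ L.mainSet
  · simp [ho]
  · simp [ho]

/-- The off part tends to `0` (dominated convergence, Tannery): every term off the main set tends to `0` and the
majorant `bound` dominates them (off the main set, `o ≠ main`). -/
theorem offPart_tendsto : Tendsto L.offPart atTop (𝓝 0) := by
  have h : Tendsto (fun N => ∑' o : Orbit, if o ∈ L.mainSet then (0 : ℂ) else term (L.level N) (L.loc N) o) atTop
      (𝓝 (∑' o : Orbit, (0 : ℂ))) := by
    refine tendsto_tsum_of_dominated_convergence L.bound_summable (fun o => ?_)
      (Eventually.of_forall fun N o => ?_)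
    · by_cases ho : o ∈ L.mainSet
      · simp [ho]
      · simp only [ho, if_false]
        exact L.tendsto_zero o ho
    · by_cases ho : o ∈ L.mainSet
      · simp only [ho, if_true, norm_zero]
        exact L.bound_nonneg o
      · simp only [ho, if_false]
        have hne : o ≠ L.main := fun h => ho (h ▸ L.main_mem)
        exact L.norm_term_le N o hne
  rw [tsum_zero] at h
  exact h

/-- **THE CONCLUSION OF THE ASSEMBLY, SUM FORM**: a localiser with a main set gives a level and a translate with
non-zero pairing.  `Re (pairing N) = Re (mainPart N) + Re (offPart N) ≥ m − ‖offPart N‖ > 0` for `N` large. -/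
theorem P (L : E.LocalizerSum) : ∃ (K : Level) (γ : Tr K), pairing K γ ≠ 0 := by
  obtain ⟨m, hm, hev⟩ := L.main_sum_lower
  have hoff : ∀ᶠ N in atTop, ‖L.offPart N‖ < m := by
    have := (L.offPart_tendsto).norm
    simp only [norm_zero] at this
    exact this.eventually (gt_mem_nhds hm)
  obtain ⟨N, hN1, hN2⟩ := (hev.and hoff).exists
  refine ⟨L.level N, L.loc N, fun h0 => ?_⟩
  have h := L.pairing_eq N
  rw [h0] at h
  have hre : (L.mainPart N).re + (L.offPart N).re = 0 := by
    have := congrArg Complex.re h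
    simpa [Complex.add_re] using this.symm
  have hre_off : -(L.offPart N).re ≤ ‖L.offPart N‖ := by
    have := Complex.abs_re_le_norm (L.offPart N)
    exact (neg_le_abs _).trans this
  have hmain : m ≤ (L.mainPart N).re := hN1
  linarith

end LocalizerSum

/-- **LOCALISER WITH A MAIN SET, plan-3's (R4) verbatim (S13393)**: as `LocalizerSum`, with the sum clause replaced by
TERMWISE POSITIVITY on the set (`main_pos`: from some depth on every term of `mainSet` is a non-negative real) and the
lower bound on the distinguished term (`main_lower`). -/
structure LocalizerSet (E : OrbitExpansion Orbit pairing term) where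
  /-- the persistent orbits -/
  mainSet : Set Orbit
  /-- the distinguished persistent orbit -/
  main : Orbit
  main_mem : main ∈ mainSet
  /-- the level of the depth-`N` localiser -/
  level : ℕ → Level
  /-- the depth-`N` localising translate, of level `level N` -/
  loc : ∀ N : ℕ, Tr (level N)
  /-- off the main set the localiser's terms tend to `0` -/
  tendsto_zero : ∀ o : Orbit, o ∉ mainSet → Tendsto (fun N => term (level N) (loc N) o) atTop (𝓝 0)
  /-- from some depth on, every term of the main set is a non-negative real -/
  main_pos : ∃ N₀ : ℕ, ∀ N, N₀ ≤ N → ∀ o ∈ mainSet,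
    (term (level N) (loc N) o).im = 0 ∧ 0 ≤ (term (level N) (loc N) o).re
  /-- the real part of the distinguished term is eventually bounded below -/
  main_lower : ∃ m : ℝ, 0 < m ∧ ∀ᶠ N in atTop, m ≤ (term (level N) (loc N) main).re
  /-- one summable majorant of the terms off `main`, for all depths -/
  bound : Orbit → ℝ
  bound_nonneg : ∀ o, 0 ≤ bound o
  bound_summable : Summable bound
  norm_term_le : ∀ (N : ℕ) (o : Orbit), o ≠ main → ‖term (level N) (loc N) o‖ ≤ bound o

namespace LocalizerSet

variable {E : OrbitExpansion Orbit pairing term} (L : E.LocalizerSet)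

/-- The summand over the main set is summable. -/
theorem summable_mainSummand (N : ℕ) :
    Summable (fun o : Orbit => if o ∈ L.mainSet then term (L.level N) (L.loc N) o else 0) := by
  refine Summable.of_norm_bounded (E.summable_norm (L.level N) (L.loc N)) ?_
  intro o
  by_cases ho : o ∈ L.mainSet
  · simp [ho]
  · simp [ho]

/-- Termwise positivity on the set gives the sum clause: eventually `Re Σ_{o ∈ mainSet} term ≥ Re (term main) ≥ m`. -/
theorem main_sum_lower : ∃ m : ℝ, 0 < m ∧ ∀ᶠ N in atTop,
    m ≤ (∑' o : Orbit, if o ∈ L.mainSet then term (L.level N) (L.loc N) o else 0).re := by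
  obtain ⟨N₀, hpos⟩ := L.main_pos
  obtain ⟨m, hm, hev⟩ := L.main_lower
  refine ⟨m, hm, ?_⟩
  filter_upwards [hev, eventually_ge_atTop N₀] with N hN hN₀
  set f : Orbit → ℂ := fun o => if o ∈ L.mainSet then term (L.level N) (L.loc N) o else 0 with hf
  have hsum : Summable f := L.summable_mainSummand N
  have hre : ∀ o, 0 ≤ (f o).re := by
    intro o
    by_cases ho : o ∈ L.mainSet
    · simp only [hf, ho, if_true]
      exact (hpos N hN₀ o ho).2
    · simp [hf, ho]
  have hmain : m ≤ (f L.main).re := by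
    simp only [hf, L.main_mem, if_true]
    exact hN
  rw [Complex.re_tsum hsum]
  exact hmain.trans ((Complex.hasSum_re hsum.hasSum).summable.le_tsum _ (fun o _ => hre o))

/-- A localiser with termwise positivity on the set is one in sum form. -/
def toLocalizerSum : E.LocalizerSum :=
  { mainSet := L.mainSet
    main := L.main
    main_mem := L.main_mem
    level := L.level
    loc := L.loc
    tendsto_zero := L.tendsto_zero
    main_sum_lower := L.main_sum_lower
    bound := L.bound
    bound_nonneg := L.bound_nonneg
    bound_summable := L.bound_summable
    norm_term_le := L.norm_term_le }

/-- **THE CONCLUSION OF THE ASSEMBLY ((R4))**: a localiser with a main set and termwise positivity on it gives a level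
and a translate with non-zero pairing. -/
theorem P (L : E.LocalizerSet) : ∃ (K : Level) (γ : Tr K), pairing K γ ≠ 0 :=
  L.toLocalizerSum.P

end LocalizerSet

end OrbitExpansion

end Assembly

end Summit.Ventures.HodgeRepro.Tier4.Line3

end
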